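import Literature.AlgebraicGeometry.Motives.MumfordTateInvariantsTensorBasis
import Literature.AlgebraicGeometry.Motives.HodgeTensor
import HarnessLib

/-!
# Integral lattices in the tensor spaces `T^{a,b} V` and their stability under integral automorphisms

Family `hodge`, layer `Literature/AlgebraicGeometry/Motives`. THEOREMS only (no definition, no named fact).
The integrality half of Deligne's argument "a finite-index subgroup of the monodromy group fixes the
(generic) Hodge tensors" (Deligne 1972, Prop. 7.5; Carlson–Müller-Stach–Peters, Lemma–Definition 15.3.7,
proof: "`Γ` acts as a finite group on Hodge tensors" — `Γ` preserves the lattice `H_ℤ` and hence the induced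
lattices of the tensor spaces; Voisin I §7.1.1 "the integral structure"): for a `ℚ`-basis `e` of `V`,

* `tensorSpaceAct_mem_span_hodgeTensorBasis` — **the `ℤ`-span `Λ^{a,b}` of the tensor basis
  `hodgeTensorBasis e a b` of `T^{a,b} V` is stable under `g · _ = g^{⊗a} ⊗ ((g⁻¹)^∨)^{⊗b}` for every
  automorphism `g` such that `g` and `g⁻¹` preserve the `ℤ`-span of `e`** (the coordinates of `g · (e_I ⊗ e^∨_J)`
  are products of matrix entries of `g` and `g⁻¹`);
* `exists_nsmul_mem_span_of_basis` — every vector of a `ℚ`-space has a positive integer multiple in the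
  `ℤ`-span of a (finite) basis (clear denominators); `fg_span_hodgeTensorBasis` — `Λ^{a,b}` is finitely generated;
* `exists_basis_span_eq_of_lattice` — **a finitely generated `ℤ`-submodule `L` of a finite-dimensional
  `ℚ`-space in which every vector has a non-zero integer multiple is the `ℤ`-span of a `ℚ`-basis** (`L` is free
  over the PID `ℤ`, Mathlib `Module.free_of_finite_type_torsion_free'`; a `ℤ`-basis of `L` is `ℚ`-free,
  `LinearIndependent.iff_fractionRing`, and spans).

## References
* [CarlsonMullerStachPeters2017] J. Carlson, S. Müller-Stach, C. Peters, Period Mappings and Period Domains,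
  2nd ed. (2017), Lemma–Definition 15.3.7 (proof).
* [Deligne1972WeilK3] P. Deligne, La conjecture de Weil pour les surfaces K3, Invent. Math. 15 (1972), Prop. 7.5.
* [VoisinHodgeI2002] C. Voisin, Hodge Theory and Complex Algebraic Geometry I, CUP 2002, §7.1.1.
-/

noncomputable section

open scoped TensorProduct PiTensorProduct

namespace Literature.AlgebraicGeometry.Motives

universe u w

variable {V : Type u} [AddCommGroup V] [Module ℚ V]

/-! ### Integer multiples in the span of a basis -/

/-- **Clearing denominators**: every vector of a `ℚ`-space with a finite basis `B` has a positive integer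
multiple in the `ℤ`-span of `B`. [cite: VoisinHodgeI2002, §7.1.1] -/
theorem exists_nsmul_mem_span_of_basis {W : Type*} [AddCommGroup W] [Module ℚ W] {κ : Type*} [Fintype κ]
    (B : Module.Basis κ ℚ W) (w : W) :
    ∃ N : ℕ, 0 < N ∧ (N : ℤ) • w ∈ Submodule.span ℤ (Set.range B) := by
  refine ⟨∏ i, (B.repr w i).den, Finset.prod_pos fun i _ => (B.repr w i).den_pos, ?_⟩
  rw [Module.Basis.mem_span_iff_repr_mem ℤ B]
  intro i
  obtain ⟨m, hm⟩ : (B.repr w i).den ∣ ∏ j, (B.repr w j).den := Finset.dvd_prod_of_mem _ (Finset.mem_univ i)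
  refine ⟨m * (B.repr w i).num, ?_⟩
  rw [← Int.cast_smul_eq_zsmul ℚ, map_smul, Finsupp.smul_apply, smul_eq_mul, hm]
  push_cast
  have h := Rat.mul_den_eq_num (B.repr w i)
  calc ((m : ℚ) * (B.repr w i).num) = m * (B.repr w i * (B.repr w i).den) := by rw [h]
    _ = ((B.repr w i).den * m) * B.repr w i := by ring

/-! ### The integral lattice of `T^{a,b} V` -/

section Tensor

variable {S : Type w} [Fintype S] [DecidableEq S]

/-- The `ℤ`-span of the tensor basis is finitely generated. [cite: CarlsonMullerStachPeters2017, Lemma–Definition 15.3.7 (proof)] -/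
theorem fg_span_hodgeTensorBasis (e : Module.Basis S ℚ V) (a b : ℕ) :
    (Submodule.span ℤ (Set.range (hodgeTensorBasis e a b))).FG :=
  Submodule.fg_span (Set.finite_range _)

/-- **The integral lattice of `T^{a,b} V` is stable under integral automorphisms**: if `g` and `g⁻¹` map
the basis vectors `e σ` into the `ℤ`-span of `e`, then `g · t = (g^{⊗a} ⊗ ((g⁻¹)^∨)^{⊗b}) t` lies in the
`ℤ`-span `Λ^{a,b}` of the tensor basis for every `t ∈ Λ^{a,b}` (the coordinates of `g · (e_I ⊗ e^∨_J)` in the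
tensor basis are products of coordinates of the `g e_σ` and of values `e^∨_τ (g⁻¹ e_σ)`, all integers).
[cite: CarlsonMullerStachPeters2017, Lemma–Definition 15.3.7 (proof)] [cite: Deligne1972WeilK3, Prop. 7.5] -/
theorem tensorSpaceAct_mem_span_hodgeTensorBasis (e : Module.Basis S ℚ V) {a b : ℕ} {g : V ≃ₗ[ℚ] V}
    (hg : ∀ σ, g (e σ) ∈ Submodule.span ℤ (Set.range e))
    (hg' : ∀ σ, g.symm (e σ) ∈ Submodule.span ℤ (Set.range e))
    {t : hodgeTensorSpace V a b} (ht : t ∈ Submodule.span ℤ (Set.range (hodgeTensorBasis e a b))) :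
    tensorSpaceAct g t ∈ Submodule.span ℤ (Set.range (hodgeTensorBasis e a b)) := by
  induction ht using Submodule.span_induction with
  | zero => rw [map_zero]; exact Submodule.zero_mem _
  | add x y _ _ hx hy => rw [map_add]; exact Submodule.add_mem _ hx hy
  | smul z x _ hx => rw [map_zsmul]; exact Submodule.smul_mem _ z hx
  | mem x hx =>
    obtain ⟨⟨β, γ⟩, rfl⟩ := hx
    rw [hodgeTensorBasis_apply]
    change tensorSpaceAct g ((PiTensorProduct.tprod ℚ fun k => e (β k)) ⊗ₜ[ℚ]
      PiTensorProduct.tprod ℚ fun l => e.dualBasis (γ l)) ∈ _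
    rw [tensorSpaceAct_tmul_tprod, Module.Basis.mem_span_iff_repr_mem ℤ]
    rintro ⟨β', γ'⟩
    change ((Basis.piTensorProduct fun _ : Fin a => e).tensorProduct
        (Basis.piTensorProduct fun _ : Fin b => e.dualBasis)).repr _ (β', γ') ∈ _
    rw [Module.Basis.tensorProduct_repr_tmul_apply, Basis.piTensorProduct_repr_tprod_apply,
      Basis.piTensorProduct_repr_tprod_apply, smul_eq_mul]
    rw [← RingHom.coe_range]
    refine mul_mem (prod_mem fun l _ => ?_) (prod_mem fun k _ => ?_)
    · -- `e^∨.repr (e^∨_{γ l} ∘ g⁻¹) (γ' l) = e^∨_{γ l} (g⁻¹ (e (γ' l))) = e.repr (g⁻¹ e_{γ' l}) (γ l) ∈ ℤ`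
      rw [Module.Basis.dualBasis_repr, LinearMap.comp_apply, LinearEquiv.coe_coe, Module.Basis.dualBasis_apply]
      exact RingHom.mem_range.2 ((Module.Basis.mem_span_iff_repr_mem ℤ e _).1 (hg' (γ' l)) (γ l))
    · exact RingHom.mem_range.2 ((Module.Basis.mem_span_iff_repr_mem ℤ e _).1 (hg (β k)) (β' k))

/-- The same stability, stated for a subgroup `Γ ≤ GL(V)` preserving the `ℤ`-span of `e` (then `γ` and
`γ⁻¹ ∈ Γ` both do). [cite: CarlsonMullerStachPeters2017, Lemma–Definition 15.3.7 (proof)] -/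
theorem tensorSpaceAct_mem_span_hodgeTensorBasis_of_mem (e : Module.Basis S ℚ V) {a b : ℕ}
    {Γ : Subgroup (V ≃ₗ[ℚ] V)} (hΓ : ∀ γ ∈ Γ, ∀ σ, γ (e σ) ∈ Submodule.span ℤ (Set.range e))
    {γ : V ≃ₗ[ℚ] V} (hγ : γ ∈ Γ)
    {t : hodgeTensorSpace V a b} (ht : t ∈ Submodule.span ℤ (Set.range (hodgeTensorBasis e a b))) :
    tensorSpaceAct γ t ∈ Submodule.span ℤ (Set.range (hodgeTensorBasis e a b)) :=
  tensorSpaceAct_mem_span_hodgeTensorBasis e (hΓ γ hγ) (hΓ γ⁻¹ (Γ.inv_mem hγ)) ht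

/-- A whole `Γ`-orbit of a tensor has a common denominator: if `Γ` preserves the `ℤ`-span of `e`, every
`t ∈ T^{a,b} V` has some `N ≥ 1` with `N · (γ · t) ∈ Λ^{a,b}` for all `γ ∈ Γ`.
[cite: CarlsonMullerStachPeters2017, Lemma–Definition 15.3.7 (proof)] -/
theorem exists_nsmul_tensorSpaceAct_mem_span (e : Module.Basis S ℚ V) {a b : ℕ}
    {Γ : Subgroup (V ≃ₗ[ℚ] V)} (hΓ : ∀ γ ∈ Γ, ∀ σ, γ (e σ) ∈ Submodule.span ℤ (Set.range e))
    (t : hodgeTensorSpace V a b) :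
    ∃ N : ℕ, 0 < N ∧ ∀ γ ∈ Γ,
      (N : ℤ) • tensorSpaceAct γ t ∈ Submodule.span ℤ (Set.range (hodgeTensorBasis e a b)) := by
  obtain ⟨N, hN, hNt⟩ := exists_nsmul_mem_span_of_basis (hodgeTensorBasis e a b) t
  refine ⟨N, hN, fun γ hγ => ?_⟩
  rw [← map_zsmul]
  exact tensorSpaceAct_mem_span_hodgeTensorBasis_of_mem e hΓ hγ hNt

end Tensor

/-! ### A full finitely generated lattice is the `ℤ`-span of a `ℚ`-basis -/

/-- **A full lattice is the `ℤ`-span of a `ℚ`-basis**: a finitely generated `ℤ`-submodule `L` of a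
`ℚ`-vector space `V` such that every vector of `V` has a non-zero integer multiple in `L` equals
`span ℤ (range e)` for some `ℚ`-basis `e` of `V` indexed by `Fin r`. (`L` is torsion-free, hence free over the
PID `ℤ`; a `ℤ`-basis of `L` is `ℚ`-linearly independent and spans `V`.) [cite: VoisinHodgeI2002, §7.1.1] -/
theorem exists_basis_span_eq_of_lattice (L : Submodule ℤ V) (hfg : L.FG)
    (hfull : ∀ v : V, ∃ N : ℤ, N ≠ 0 ∧ N • v ∈ L) :
    ∃ (r : ℕ) (e : Module.Basis (Fin r) ℚ V), Submodule.span ℤ (Set.range e) = L := by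
  haveI : Module.Finite ℤ L := Module.Finite.iff_fg.2 hfg
  haveI : IsAddTorsionFree V := by
    refine ⟨fun {n} hn x y hxy => ?_⟩
    have h : (n : ℚ) • x = (n : ℚ) • y := by
      rw [Nat.cast_smul_eq_nsmul, Nat.cast_smul_eq_nsmul]; exact hxy
    exact smul_right_injective V (Nat.cast_ne_zero.2 hn) h
  haveI : IsAddTorsionFree L := by
    refine ⟨fun {n} hn x y hxy => ?_⟩
    apply Subtype.ext
    have h : n • (x : V) = n • (y : V) := by
      have := congrArg (fun z : L => (z : V)) hxy
      simpa only [Submodule.coe_smul_of_tower] using this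
    exact IsAddTorsionFree.nsmul_right_injective hn h
  obtain ⟨r, bL⟩ : Σ n : ℕ, Module.Basis (Fin n) ℤ L := Module.basisOfFiniteTypeTorsionFree'
  -- the vectors of `bL` in `V`
  let v : Fin r → V := fun i => (bL i : V)
  have hvL : Submodule.span ℤ (Set.range v) = L := by
    have h1 : Set.range v = L.subtype '' Set.range bL := by
      ext x
      simp only [v, Set.mem_range, Set.mem_image, Submodule.coe_subtype, exists_exists_eq_and]
    rw [h1, ← Submodule.map_span, bL.span_eq, Submodule.map_top, Submodule.range_subtype]
  have hliZ : LinearIndependent ℤ v := bL.linearIndependent.map' L.subtype L.ker_subtype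
  have hliQ : LinearIndependent ℚ v := (LinearIndependent.iff_fractionRing ℤ ℚ).1 hliZ
  have hsp : ⊤ ≤ Submodule.span ℚ (Set.range v) := by
    intro x _
    obtain ⟨N, hN0, hNx⟩ := hfull x
    have hmem : (N : ℚ) • x ∈ Submodule.span ℚ (Set.range v) := by
      rw [Int.cast_smul_eq_zsmul]
      rw [← hvL] at hNx
      exact Submodule.span_subset_span ℤ ℚ _ hNx
    have hx : x = (N : ℚ)⁻¹ • ((N : ℚ) • x) := by
      rw [smul_smul, inv_mul_cancel₀ (Int.cast_ne_zero.2 hN0), one_smul]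
    rw [hx]
    exact Submodule.smul_mem _ _ hmem
  refine ⟨r, Module.Basis.mk hliQ hsp, ?_⟩
  rw [Module.Basis.coe_mk, hvL]

end Literature.AlgebraicGeometry.Motives

end
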